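import Literature.Topology.FourManifolds.SphereProductThomKronecker
import Literature.Topology.FourManifolds.SphereProductThomFundamentalClass
import HarnessLib

/-!
# For `k` even the swap of `Sᵏ × Sᵏ` preserves every `ℤ`-orientation

Topic `Literature/Topology/FourManifolds` (fact seat of
`Literature.Topology.FourManifolds.HomotopySphere.exists_intersectionForm_equivalent_e8Form`,
Kosinski's `E₈` plumbing `M(4m)`, *Differential Manifolds* (1993), VI.12). The plumbing
identification `(x, y) ↦ (y, x)` of two copies of the tangent disc bundle of `S²ᵐ` (VI.12,
p. 120) is, in the tree's model (`PlumbingSphereGeometry.lean`, `PlumbingChart.lean`),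
conjugate to the swap `σ(p, q) = (q, p)` of `Sᵏ × Sᵏ`; the orientation bookkeeping of the
plumbing ("the pieces of `M(4n)` are oriented coherently", so that all eight self-intersection
numbers are `+2`, VI.(12.4)) rests on the fact proved here: **for `k` even, `σ` preserves
every `ℤ`-orientation of `Sᵏ × Sᵏ`**. The proof is global and cohomological (no Jacobians):
`σ^* g₁ = g₂`, so `σ^*(g₁ ⌣ g₂) = g₂ ⌣ g₁ = (-1)^{k²} g₁ ⌣ g₂ = g₁ ⌣ g₂` (Hatcher 2002,
Thm. 3.11), hence `⟨g₁ ⌣ g₂, σ₊[X]_μ⟩ = ⟨g₁ ⌣ g₂, [X]_μ⟩ = ±1 ≠ 0`; on the other hand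
`σ₊[X]_μ = [X]_{μ.comap σ}` (naturality of fundamental classes) and `μ.comap σ = ±μ`
(`Sᵏ × Sᵏ` is connected), and the sign `-` would give `⟨g₁ ⌣ g₂, σ₊[X]_μ⟩ = -⟨g₁ ⌣ g₂, [X]_μ⟩`.
So `μ.comap σ = μ`.

* the swap is Mathlib's `Homeomorph.prodComm` / `ContinuousMap.prodSwap`
  (`coe_prodComm_sphere`);
* `SphereProd.map_prodSwap_g_zero/one`, `SphereProd.map_prodSwap_cupProduct_g`,
  `SphereProd.kroneckerPairing_cupProduct_g_map_prodSwap` — `σ^*` on `Hᵏ`, on `g₁ ⌣ g₂`, and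
  `⟨g₁ ⌣ g₂, σ₊ c⟩ = ⟨g₁ ⌣ g₂, c⟩` (`k` even);
* **`SphereProd.comap_prodComm`** — `μ.comap σ = μ` for every `ℤ`-orientation `μ` in degree
  `n + 1 = 2k`, `k ≥ 2` even; `SphereProd.map_prodSwap_fundamentalClass` — `σ₊[X]_μ = [X]_μ`;
  `SphereProd.map_prodSwap_localClass` — `σ₊ μₓ = μ_{σ x}` (the form used for local degrees).

Everything is proved; no definitions, no named facts (D-0026).

## References

* A. Kosinski, *Differential Manifolds*, Academic Press 1993, VI.12 p. 120, (12.4).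
  [Kosinski1993]
* A. Hatcher, *Algebraic Topology*, CUP 2002, Thm. 3.11 (graded commutativity), Example 3.11,
  §3.3 Thm. 3.26 and p. 234 (two orientations of a connected manifold). [HatcherAT2002]
-/

open scoped Manifold ContDiff Topology
open Set Function CategoryTheory CategoryTheory.Limits Topology

noncomputable section

namespace Literature.Topology.FourManifolds

open Literature.AlgebraicTopology.SingularHomology

namespace SphereProd

variable {k n : ℕ}

/-! ### The swap -/

/-- The swap `σ(p, q) = (q, p)` of `Sᵏ × Sᵏ` as a homeomorphism is Mathlib's
`Homeomorph.prodComm`; as a continuous map it is `ContinuousMap.prodSwap`; the two agree.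
[folklore] -/
theorem coe_prodComm_sphere :
    (Homeomorph.prodComm (Metric.sphere (0 : EuclideanSpace ℝ (Fin (k + 1))) 1) (Metric.sphere (0 : EuclideanSpace ℝ (Fin (k + 1))) 1) : C((Metric.sphere (0 : EuclideanSpace ℝ (Fin (k + 1))) 1) × (Metric.sphere (0 : EuclideanSpace ℝ (Fin (k + 1))) 1), (Metric.sphere (0 : EuclideanSpace ℝ (Fin (k + 1))) 1) × (Metric.sphere (0 : EuclideanSpace ℝ (Fin (k + 1))) 1))) =
      ContinuousMap.prodSwap (α := (Metric.sphere (0 : EuclideanSpace ℝ (Fin (k + 1))) 1)) (β := (Metric.sphere (0 : EuclideanSpace ℝ (Fin (k + 1))) 1)) := rfl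

/-- `prodSwap_apply'` (prodSwap apply). [folklore] -/
theorem prodSwap_apply' (x : (Metric.sphere (0 : EuclideanSpace ℝ (Fin (k + 1))) 1) × (Metric.sphere (0 : EuclideanSpace ℝ (Fin (k + 1))) 1)) :
  (ContinuousMap.prodSwap (α := (Metric.sphere (0 : EuclideanSpace ℝ (Fin (k + 1))) 1)) (β := (Metric.sphere (0 : EuclideanSpace ℝ (Fin (k + 1))) 1))) x = x.swap := rfl

/-- `pr₁ ∘ σ = pr₂`. [folklore] -/
theorem pr_zero_comp_prodSwap : (pr k 0).comp
  (ContinuousMap.prodSwap (α := (Metric.sphere (0 : EuclideanSpace ℝ (Fin (k + 1))) 1)) (β := (Metric.sphere (0 : EuclideanSpace ℝ (Fin (k + 1))) 1))) = pr k 1 := rfl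

/-- `pr₂ ∘ σ = pr₁`. [folklore] -/
theorem pr_one_comp_prodSwap : (pr k 1).comp
  (ContinuousMap.prodSwap (α := (Metric.sphere (0 : EuclideanSpace ℝ (Fin (k + 1))) 1)) (β := (Metric.sphere (0 : EuclideanSpace ℝ (Fin (k + 1))) 1))) = pr k 0 := rfl

/-! ### `σ^*` on `Hᵏ` and on `g₁ ⌣ g₂` -/

/-- **`σ^* g₁ = g₂`** (`gₐ = prₐ^* γ`, `pr₁ ∘ σ = pr₂`). [cite: HatcherAT2002, Example 3.11] -/
theorem map_prodSwap_g_zero (hk : 2 ≤ k) :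
    singularCohomology.map ℤ ℤ
      (ContinuousMap.prodSwap (α := (Metric.sphere (0 : EuclideanSpace ℝ (Fin (k + 1))) 1)) (β := (Metric.sphere (0 : EuclideanSpace ℝ (Fin (k + 1))) 1))) k (g hk 0) = g hk 1 := by
  change (singularCohomology.map ℤ ℤ (pr k 0) k ≫ singularCohomology.map ℤ ℤ
    (ContinuousMap.prodSwap (α := (Metric.sphere (0 : EuclideanSpace ℝ (Fin (k + 1))) 1)) (β := (Metric.sphere (0 : EuclideanSpace ℝ (Fin (k + 1))) 1))) k)
    (γ hk) = _
  rw [← singularCohomology.map_comp, pr_zero_comp_prodSwap]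
  rfl

/-- **`σ^* g₂ = g₁`**. [cite: HatcherAT2002, Example 3.11] -/
theorem map_prodSwap_g_one (hk : 2 ≤ k) :
    singularCohomology.map ℤ ℤ
      (ContinuousMap.prodSwap (α := (Metric.sphere (0 : EuclideanSpace ℝ (Fin (k + 1))) 1)) (β := (Metric.sphere (0 : EuclideanSpace ℝ (Fin (k + 1))) 1))) k (g hk 1) = g hk 0 := by
  change (singularCohomology.map ℤ ℤ (pr k 1) k ≫ singularCohomology.map ℤ ℤ
    (ContinuousMap.prodSwap (α := (Metric.sphere (0 : EuclideanSpace ℝ (Fin (k + 1))) 1)) (β := (Metric.sphere (0 : EuclideanSpace ℝ (Fin (k + 1))) 1))) k)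
    (γ hk) = _
  rw [← singularCohomology.map_comp, pr_one_comp_prodSwap]
  rfl

/-- **`σ^*(g₁ ⌣ g₂) = g₂ ⌣ g₁`** (naturality of the cup product, Hatcher Prop. 3.10).
[cite: HatcherAT2002, Prop. 3.10] -/
theorem map_prodSwap_cupProduct_g (hk : 2 ≤ k) {D : ℕ} (hD : k + k = D) :
    singularCohomology.map ℤ ℤ
      (ContinuousMap.prodSwap (α := (Metric.sphere (0 : EuclideanSpace ℝ (Fin (k + 1))) 1)) (β := (Metric.sphere (0 : EuclideanSpace ℝ (Fin (k + 1))) 1))) D (cupProduct hD (g hk 0) (g hk 1)) =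
      cupProduct hD (g hk 1) (g hk 0) := by
  rw [cupProduct_map, map_prodSwap_g_zero, map_prodSwap_g_one]

/-- **For `k` even, `⟨g₁ ⌣ g₂, σ₊ c⟩ = ⟨g₁ ⌣ g₂, c⟩`** for every class `c ∈ H₂ₖ(Sᵏ × Sᵏ; ℤ)`:
`⟨g₁ ⌣ g₂, σ₊ c⟩ = ⟨σ^*(g₁ ⌣ g₂), c⟩ = ⟨g₂ ⌣ g₁, c⟩ = (-1)^{k·k} ⟨g₁ ⌣ g₂, c⟩` (naturality of
the Kronecker pairing and graded commutativity, Hatcher §3.1 p. 201, Thm. 3.11).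
[cite: HatcherAT2002, Thm. 3.11 and §3.1 p. 201] -/
theorem kroneckerPairing_cupProduct_g_map_prodSwap (hk : 2 ≤ k) (hke : Even k) {D : ℕ}
    (hD : k + k = D) (c : singularHomology ℤ ℤ ((Metric.sphere (0 : EuclideanSpace ℝ (Fin (k + 1))) 1) × (Metric.sphere (0 : EuclideanSpace ℝ (Fin (k + 1))) 1)) D) :
    kroneckerPairing ℤ ℤ _ D (cupProduct hD (g hk 0) (g hk 1))
        (singularHomology.map ℤ ℤ (ContinuousMap.prodSwap (α := (Metric.sphere (0 : EuclideanSpace ℝ (Fin (k + 1))) 1)) (β := (Metric.sphere (0 : EuclideanSpace ℝ (Fin (k + 1))) 1))) D c) =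
      kroneckerPairing ℤ ℤ _ D (cupProduct hD (g hk 0) (g hk 1)) c := by
  rw [← kroneckerPairing_map, map_prodSwap_cupProduct_g hk hD,
    cupProduct_gradedComm_holds ℤ _ hD hD (g hk 1) (g hk 0),
    (kroneckerPairing ℤ ℤ ((Metric.sphere (0 : EuclideanSpace ℝ (Fin (k + 1))) 1) × (Metric.sphere (0 : EuclideanSpace ℝ (Fin (k + 1))) 1)) D).map_smul, LinearMap.smul_apply, smul_eq_mul,
    Even.neg_one_pow (hke.mul_right k), one_mul]

/-! ### `σ` preserves every `ℤ`-orientation (`k` even) -/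

/-- **For `k ≥ 2` even, the swap preserves every `ℤ`-orientation of `Sᵏ × Sᵏ`:
`μ.comap σ = μ`** (orientations in degree `n + 1 = 2k`). Proof: `σ₊[X]_μ = [X]_{μ.comap σ}`
(naturality of fundamental classes) and `μ.comap σ = ±μ` (connectedness, Hatcher p. 234); the
sign `-` is excluded because `⟨g₁ ⌣ g₂, σ₊[X]_μ⟩ = ⟨g₁ ⌣ g₂, [X]_μ⟩ = ±1`
(`kroneckerPairing_cupProduct_g_map_prodSwap`, `abs_kroneckerPairing_cupProduct_g`) while
`[X]_{-μ} = -[X]_μ`. This is the orientation bookkeeping behind the coherent orientation of the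
pieces of Kosinski's plumbing `M(4n)` (VI.12 p. 120: the identification `(x, y) ↦ (y, x)`;
(12.4): all `[Σᵢ : Σᵢ] = +2`).
[cite: Kosinski1993, VI.12 p. 120 and (12.4)]
[cite: HatcherAT2002, Thm. 3.11, §3.3 Thm. 3.26 and p. 234] -/
theorem comap_prodComm (hk : 2 ≤ k) (hke : Even k) (hkn : k + k = n + 1)
    (μ : HomologicalOrientation ℤ ((Metric.sphere (0 : EuclideanSpace ℝ (Fin (k + 1))) 1) × (Metric.sphere (0 : EuclideanSpace ℝ (Fin (k + 1))) 1)) (n + 1)) :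
    μ.comap (Homeomorph.prodComm (Metric.sphere (0 : EuclideanSpace ℝ (Fin (k + 1))) 1) (Metric.sphere (0 : EuclideanSpace ℝ (Fin (k + 1))) 1)) = μ := by
  letI : ChartedSpace (EuclideanSpace ℝ (Fin (n + 1))) ((Metric.sphere (0 : EuclideanSpace ℝ (Fin (k + 1))) 1) × (Metric.sphere (0 : EuclideanSpace ℝ (Fin (k + 1))) 1)) := chartedSpace' hkn
  haveI : PathConnectedSpace (Metric.sphere (0 : EuclideanSpace ℝ (Fin (k + 1))) 1) := pathConnectedSpace_sphere (by omega)
  -- `[X]_{μ.comap σ} = σ₊ [X]_μ`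
  have hcomap := HomologicalOrientation.fundamentalClass_comap_holds ℤ ((Metric.sphere (0 : EuclideanSpace ℝ (Fin (k + 1))) 1) × (Metric.sphere (0 : EuclideanSpace ℝ (Fin (k + 1))) 1))
    ((Metric.sphere (0 : EuclideanSpace ℝ (Fin (k + 1))) 1) × (Metric.sphere (0 : EuclideanSpace ℝ (Fin (k + 1))) 1)) (n + 1) μ (Homeomorph.prodComm (Metric.sphere (0 : EuclideanSpace ℝ (Fin (k + 1))) 1) (Metric.sphere (0 : EuclideanSpace ℝ (Fin (k + 1))) 1))
  rw [singularHomology.mapIso_inv, Homeomorph.prodComm_symm, coe_prodComm_sphere] at hcomap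
  -- the Kronecker number `R = ⟨g₁ ⌣ g₂, [X]_μ⟩ = ±1` is unchanged under `σ₊`
  set R : ℤ := kroneckerPairing ℤ ℤ _ (n + 1) (cupProduct hkn (g hk 0) (g hk 1))
    μ.fundamentalClass with hRdef
  have hR : |R| = 1 := abs_kroneckerPairing_cupProduct_g hk hkn μ
  have hpair : kroneckerPairing ℤ ℤ _ (n + 1) (cupProduct hkn (g hk 0) (g hk 1))
      (singularHomology.map ℤ ℤ
        (ContinuousMap.prodSwap (α := (Metric.sphere (0 : EuclideanSpace ℝ (Fin (k + 1))) 1)) (β := (Metric.sphere (0 : EuclideanSpace ℝ (Fin (k + 1))) 1))) (n + 1) μ.fundamentalClass) = R :=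
    kroneckerPairing_cupProduct_g_map_prodSwap hk hke hkn _
  rcases HomologicalOrientation.eq_or_eq_neg_of_connected_holds ((Metric.sphere (0 : EuclideanSpace ℝ (Fin (k + 1))) 1) × (Metric.sphere (0 : EuclideanSpace ℝ (Fin (k + 1))) 1))
    (μ.comap (Homeomorph.prodComm (Metric.sphere (0 : EuclideanSpace ℝ (Fin (k + 1))) 1) (Metric.sphere (0 : EuclideanSpace ℝ (Fin (k + 1))) 1))) μ with h | h
  · exact h
  · exfalso
    rw [h, HomologicalOrientation.fundamentalClass_neg_holds ℤ ((Metric.sphere (0 : EuclideanSpace ℝ (Fin (k + 1))) 1) × (Metric.sphere (0 : EuclideanSpace ℝ (Fin (k + 1))) 1)) (n + 1) μ]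
      at hcomap
    rw [← hcomap, map_neg] at hpair
    have hR0 : R = 0 := by linarith
    rw [hR0, abs_zero] at hR
    exact zero_ne_one hR

/-- **`σ₊ [X]_μ = [X]_μ`** for `k ≥ 2` even and every `ℤ`-orientation `μ` of `Sᵏ × Sᵏ` in
degree `n + 1 = 2k`. [cite: HatcherAT2002, §3.3 Thm. 3.26] [cite: Kosinski1993, VI.12 p. 120] -/
theorem map_prodSwap_fundamentalClass (hk : 2 ≤ k) (hke : Even k) (hkn : k + k = n + 1)
    (μ : HomologicalOrientation ℤ ((Metric.sphere (0 : EuclideanSpace ℝ (Fin (k + 1))) 1) × (Metric.sphere (0 : EuclideanSpace ℝ (Fin (k + 1))) 1)) (n + 1)) :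
    singularHomology.map ℤ ℤ
      (ContinuousMap.prodSwap (α := (Metric.sphere (0 : EuclideanSpace ℝ (Fin (k + 1))) 1)) (β := (Metric.sphere (0 : EuclideanSpace ℝ (Fin (k + 1))) 1)))
      (n + 1) μ.fundamentalClass = μ.fundamentalClass := by
  letI : ChartedSpace (EuclideanSpace ℝ (Fin (n + 1))) ((Metric.sphere (0 : EuclideanSpace ℝ (Fin (k + 1))) 1) × (Metric.sphere (0 : EuclideanSpace ℝ (Fin (k + 1))) 1)) := chartedSpace' hkn
  have hcomap := HomologicalOrientation.fundamentalClass_comap_holds ℤ ((Metric.sphere (0 : EuclideanSpace ℝ (Fin (k + 1))) 1) × (Metric.sphere (0 : EuclideanSpace ℝ (Fin (k + 1))) 1))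
    ((Metric.sphere (0 : EuclideanSpace ℝ (Fin (k + 1))) 1) × (Metric.sphere (0 : EuclideanSpace ℝ (Fin (k + 1))) 1)) (n + 1) μ (Homeomorph.prodComm (Metric.sphere (0 : EuclideanSpace ℝ (Fin (k + 1))) 1) (Metric.sphere (0 : EuclideanSpace ℝ (Fin (k + 1))) 1))
  rw [singularHomology.mapIso_inv, Homeomorph.prodComm_symm, coe_prodComm_sphere,
    comap_prodComm hk hke hkn μ] at hcomap
  exact hcomap.symm

/-- `σ` maps the complement of `{x}` into the complement of `{σ x}`. [folklore] -/
theorem mapsTo_prodSwap_compl (x : (Metric.sphere (0 : EuclideanSpace ℝ (Fin (k + 1))) 1) × (Metric.sphere (0 : EuclideanSpace ℝ (Fin (k + 1))) 1)) :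
    MapsTo
      (ContinuousMap.prodSwap (α := (Metric.sphere (0 : EuclideanSpace ℝ (Fin (k + 1))) 1)) (β := (Metric.sphere (0 : EuclideanSpace ℝ (Fin (k + 1))) 1)))
      ({x}ᶜ : Set ((Metric.sphere (0 : EuclideanSpace ℝ (Fin (k + 1))) 1) × (Metric.sphere (0 : EuclideanSpace ℝ (Fin (k + 1))) 1))) ({x.swap}ᶜ : Set ((Metric.sphere (0 : EuclideanSpace ℝ (Fin (k + 1))) 1) × (Metric.sphere (0 : EuclideanSpace ℝ (Fin (k + 1))) 1))) := by
  intro y hy h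
  apply hy
  rw [mem_singleton_iff] at h ⊢
  have := congrArg Prod.swap h
  simpa using this

/-- **`σ₊ μₓ = μ_{σ x}` on local classes** (`k ≥ 2` even, every `ℤ`-orientation `μ` of
`Sᵏ × Sᵏ` in degree `n + 1 = 2k`): the pointwise form of `comap_prodComm`.
[cite: HatcherAT2002, §3.3 p. 234] [cite: Kosinski1993, VI.12 p. 120] -/
theorem map_prodSwap_localClass (hk : 2 ≤ k) (hke : Even k) (hkn : k + k = n + 1)
    (μ : HomologicalOrientation ℤ ((Metric.sphere (0 : EuclideanSpace ℝ (Fin (k + 1))) 1) × (Metric.sphere (0 : EuclideanSpace ℝ (Fin (k + 1))) 1)) (n + 1)) (x : (Metric.sphere (0 : EuclideanSpace ℝ (Fin (k + 1))) 1) × (Metric.sphere (0 : EuclideanSpace ℝ (Fin (k + 1))) 1)) :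
    relativeSingularHomology.map ℤ ℤ
      (ContinuousMap.prodSwap (α := (Metric.sphere (0 : EuclideanSpace ℝ (Fin (k + 1))) 1)) (β := (Metric.sphere (0 : EuclideanSpace ℝ (Fin (k + 1))) 1))) (mapsTo_prodSwap_compl x) (n + 1)
        (μ.localClass x) = μ.localClass x.swap := by
  have key : (μ.comap (Homeomorph.prodComm (Metric.sphere (0 : EuclideanSpace ℝ (Fin (k + 1))) 1) (Metric.sphere (0 : EuclideanSpace ℝ (Fin (k + 1))) 1))).localClass x.swap =
      μ.localClass x.swap := by
    rw [comap_prodComm hk hke hkn μ]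
  rw [HomologicalOrientation.comap_localClass] at key
  exact key

/-- **`σ₊ μₓ = μ_q` whenever `σ x = q`** — the flexible-point form of
`map_prodSwap_localClass` (no transport between the fibres `Hₙ₊₁(X | σ x)` and `Hₙ₊₁(X | q)`).
[cite: HatcherAT2002, §3.3 p. 234] -/
theorem map_prodSwap_localClass' (hk : 2 ≤ k) (hke : Even k) (hkn : k + k = n + 1)
    (μ : HomologicalOrientation ℤ ((Metric.sphere (0 : EuclideanSpace ℝ (Fin (k + 1))) 1) × (Metric.sphere (0 : EuclideanSpace ℝ (Fin (k + 1))) 1)) (n + 1)) (x q : (Metric.sphere (0 : EuclideanSpace ℝ (Fin (k + 1))) 1) × (Metric.sphere (0 : EuclideanSpace ℝ (Fin (k + 1))) 1))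
    (hq : x.swap = q)
    (h : MapsTo
      (ContinuousMap.prodSwap (α := (Metric.sphere (0 : EuclideanSpace ℝ (Fin (k + 1))) 1)) (β := (Metric.sphere (0 : EuclideanSpace ℝ (Fin (k + 1))) 1)))
      ({x}ᶜ : Set ((Metric.sphere (0 : EuclideanSpace ℝ (Fin (k + 1))) 1) × (Metric.sphere (0 : EuclideanSpace ℝ (Fin (k + 1))) 1))) ({q}ᶜ : Set ((Metric.sphere (0 : EuclideanSpace ℝ (Fin (k + 1))) 1) × (Metric.sphere (0 : EuclideanSpace ℝ (Fin (k + 1))) 1)))) :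
    relativeSingularHomology.map ℤ ℤ
      (ContinuousMap.prodSwap (α := (Metric.sphere (0 : EuclideanSpace ℝ (Fin (k + 1))) 1)) (β := (Metric.sphere (0 : EuclideanSpace ℝ (Fin (k + 1))) 1)))
      h (n + 1) (μ.localClass x) = μ.localClass q := by
  subst hq
  exact map_prodSwap_localClass hk hke hkn μ x

end SphereProd

end Literature.Topology.FourManifolds
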